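import Literature.AnabelianGeometry.EtaleTheta.Discharge.Sec2LiftingProofs
import Literature.AnabelianGeometry.EtaleTheta.Discharge.Sec2ModelKummerLifting
import Literature.AnabelianGeometry.SemiGraphs.TemperedCurveBridge
import HarnessLib

/-!
# [EtTh] Cor 2.18 (iii) (the quotient `Π• ↠ Π•_Y`) and Cor 2.18 (iv) (fibres): the two named facts
# CHARACTERISED over the interface, and Cor 2.18 (iii) for the §1 model by name (proof-only)

Mochizuki, *The Étale Theta Function and its Frobenioid-theoretic Manifestations* [EtTh],
Publ. RIMS 45 (2009), §2: Cor 2.18 (iii) p.61 ("The algorithm for constructing the quotient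
`Π• ↠ Π•_Y` is precisely the content of Proposition 2.11, (ii)"), Prop 2.11 (ii) p.44, Cor 2.18 (iv)
pp.61–63 ("`Hom(Π•_Y/Π•_Ÿ, Ker(Π• ↠ Π•_Y))`") (locators `p.N` = PDF pages of the PRIMS text; bib key
`MochizukiEtTh2009`). PROOF-ONLY companion of `ThetaRigidity.lean` (seat abc-iut-L2-t2), of
`ThetaSystems.lean` (`RigidData.cor218_iii_quotient_of_slim`) and of
`Discharge/Sec2LiftingProofs.lean` (seat abc-iut-L2-t10, `RigidData.cor218_iv_fibre_of_prop214_i`).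
Cell abc-iut, block F (fact-proving wave), seat abc-iut-f-147, FROZEN FACT-LIST rows F-0623
`RigidData.Cor218_iii_quotient` and F-0624 `RigidData.Cor218_iv_fibre` (tranche 147). Both rows are
SCHEMAS over the lawless interface `RigidData N l` (universal closures refuted at explicit toys by
abc-iut-w5-d175: `RigidData.Toy.not_forall_cor218_iii_quotient`, `RigidData.ToyN3.not_forall_cor218_iv_fibre`);
this file pins down, for EVERY `R : RigidData N l`, exactly what each row asserts:

* §1 `RigidData.cor218_iii_quotient_iff_slim` — **F-0623 ⟺ temp-slimness of `Π^tp_Y`** ("every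
  element of `Π^tp_Y` centralising an open subgroup of `Π^tp_Y` is trivial", [SemiAnbd] Ex. 3.10 for
  the open subgroup `Π^tp_Y ⊆ Π^tp_X`). The inclusion `Ker(Π^tp_Y[μ_N] ↠ Π^tp_Y) ⊆ ⋃_U Z(U)` holds
  for every `R` (`ThetaEnvData.ker_proj_le_centralizerUnion`: `μ_N` centralises the open subgroup
  lying over `Ker(χ)`); the converse inclusion FORCES temp-slimness of `Π^tp_Y`
  (`CycEnvelope.slim_of_centralizerUnion_le`: `s^alg(U)` is open in `Π^tp_Y[μ_N]` — `μ_N` is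
  discrete — and is centralised by `s^alg(z)`), and temp-slimness gives the row back
  (`RigidData.cor218_iii_quotient_of_slim`, seat abc-iut-L2-t2).
* §2 `RigidData.cor218_iv_fibre_iff_inMu_fixed` — **F-0624 ⟺ "every automorphism of the model
  mono-theta environment `M(η)` inducing the identity on `Π^tp_Y` fixes the cyclotome `μ_N`
  pointwise"**. Seat abc-iut-L2-t10's proof of `cor218_iv_fibre_of_prop214_i` uses Prop 2.14 (i)
  only through this pointwise fixing (`inMu_fixed_of_prop214_i`); §2 re-threads that proof through the
  fixing hypothesis itself (`cor218_iv_fibre_of_inMu_fixed`) and proves the converse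
  (`inMu_fixed_of_cor218_iv_fibre`: a `μ_N`-conjugate of a twist by `φ ∈ Hom(Π^tp_Y/Π^tp_Ÿ, μ_N)` is
  the identity on `μ_N`). This is exactly the clause that fails at the level-`3` toy (the flip
  inverts `μ_3`).
* §3 the row F-0623 AT THE §1 MODEL `C.rigidData μ hC hS h15 L` of seat abc-iut-L2-t8, BY NAME:
  `rigidData_cor218_iii_quotient_of_isSlimGroup` (⟸ temp-slimness of `Π^tp_X`, the tree's
  `IsSlimGroup`, via abc-iut-L2-d1's `tempSlim_Huu`), `rigidData_cor218_iii_quotient_of_groupLevelData`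
  (the same with `Π^tp_X` temp-slim supplied by the §6 parameter bundle `TemperedCurve.GroupLevelData`),
  and `rigidData_cor218_iii_quotient_iff` (⟺ temp-slimness of `Π^tp_Y̲̲`).

HONEST FRAMING: kernel-checked equivalences / conditional discharges over the interface; nothing is
asserted about [EtTh] (a refereed paper) beyond what is proved; no side is taken on [IUTchIII]
Cor 3.12; typed ≠ proved. No `def`, no new named fact, no `instance`.
-/

noncomputable section

namespace Literature.AnabelianGeometry.EtaleTheta

open Literature.AnabelianGeometry.SemiGraphs
open Literature.AlgebraicGeometry.Frobenioids (IsSlimGroup)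

universe u

/-! ## §1. Cor 2.18 (iii), the quotient `Π• ↠ Π•_Y`: F-0623 ⟺ temp-slimness of `Π^tp_Y` -/

namespace CycEnvelope

variable {P G μ : Type*} [Group P] [Group G] [CommGroup μ] (aug : P →* G) (χ : G →* MulAut μ)

/-- **Half of Prop 2.11 (ii) that needs no slimness**: the cyclotome `Ker(Π[μ_N] ↠ Π) = μ_N`
centralises the open subgroup of `Π[μ_N]` lying over `Ker(χ ∘ aug)`, so it lies in the union of the
centralisers of the open subgroups — for ANY augmented topological group with continuous action on
`μ_N`. [cite: MochizukiEtTh2009, Prop 2.11(ii) p.44] -/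
theorem ker_proj_le_centralizerUnion [TopologicalSpace P] [TopologicalSpace μ]
    (hχ : IsOpen (((χ.comp aug).ker : Subgroup P) : Set P)) :
    (proj aug χ).ker ≤ centralizerUnion (CycEnvelope aug χ) := by
  intro z hz
  rw [MonoidHom.mem_ker] at hz
  change z.right = 1 at hz
  refine ⟨((χ.comp aug).ker).comap (proj aug χ), (continuous_proj aug χ).isOpen_preimage _ hχ, ?_⟩
  rw [Subgroup.mem_centralizer_iff]
  intro u hu
  rw [SetLike.mem_coe, Subgroup.mem_comap, MonoidHom.mem_ker] at hu
  change χ (aug u.right) = 1 at hu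
  ext
  · simp [hz, hu, mul_comm]
  · simp [hz]

/-- The image `s^alg(U)` of a subset `U ⊆ Π` under the tautological section is the slice
`{1} × U` of `Π[μ_N] = μ_N × Π`; it is open when `U` is open and `μ_N` is discrete.
[cite: MochizukiEtTh2009, Def 2.10 p.44] -/
theorem isOpen_map_algSection [TopologicalSpace P] [TopologicalSpace μ] [DiscreteTopology μ]
    (U : Subgroup P) (hU : IsOpen (U : Set P)) :
    IsOpen ((U.map (algSection aug χ) : Subgroup (CycEnvelope aug χ)) : Set (CycEnvelope aug χ)) := by
  have hset : ((U.map (algSection aug χ) : Subgroup (CycEnvelope aug χ)) : Set (CycEnvelope aug χ)) =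
      (fun x : CycEnvelope aug χ => (x.left, x.right)) ⁻¹' (({1} : Set μ) ×ˢ (U : Set P)) := by
    ext x
    simp only [Subgroup.coe_map, Set.mem_image, SetLike.mem_coe, Set.mem_preimage, Set.mem_prod,
      Set.mem_singleton_iff]
    constructor
    · rintro ⟨u, hu, rfl⟩
      exact ⟨rfl, hu⟩
    · rintro ⟨h1, h2⟩
      exact ⟨x.right, h2, by ext <;> simp [h1]⟩
  rw [hset]
  exact isOpen_induced ((isOpen_discrete _).prod hU)

/-- **The converse half of Prop 2.11 (ii) forces temp-slimness**: if the union of the centralisers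
of the open subgroups of `Π[μ_N]` is contained in `Ker(Π[μ_N] ↠ Π)` (and `μ_N` is discrete), then
every element of `Π` centralising an open subgroup of `Π` is trivial — since `s^alg(z)` centralises
the open subgroup `s^alg(U)`. [cite: MochizukiEtTh2009, Prop 2.11(ii) p.44] -/
theorem slim_of_centralizerUnion_le [TopologicalSpace P] [TopologicalSpace μ] [DiscreteTopology μ]
    (h : centralizerUnion (CycEnvelope aug χ) ≤ (proj aug χ).ker) :
    ∀ U : Subgroup P, IsOpen (U : Set P) → ∀ z : P, (∀ u ∈ U, z * u = u * z) → z = 1 := by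
  intro U hU z hz
  have hmem : algSection aug χ z ∈ centralizerUnion (CycEnvelope aug χ) := by
    refine ⟨U.map (algSection aug χ), isOpen_map_algSection aug χ U hU, ?_⟩
    rw [Subgroup.mem_centralizer_iff]
    rintro _ ⟨u, hu, rfl⟩
    rw [← map_mul, ← map_mul, hz u hu]
  have hker := h hmem
  rw [MonoidHom.mem_ker] at hker
  simpa using hker

/-- **Prop 2.11 (ii) as an equivalence**: for an augmented topological group `Π` acting continuously
on a discrete cyclotome `μ_N`, "`Ker(Π[μ_N] ↠ Π)` = the union of the centralisers of the open
subgroups of `Π[μ_N]`" holds IF AND ONLY IF `Π` is temp-slim (every element centralising an open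
subgroup is trivial). [cite: MochizukiEtTh2009, Prop 2.11(ii) p.44] -/
theorem centralizerUnion_eq_ker_iff_slim [TopologicalSpace P] [IsTopologicalGroup P]
    [TopologicalSpace μ] [DiscreteTopology μ]
    (hχ : IsOpen (((χ.comp aug).ker : Subgroup P) : Set P)) :
    centralizerUnion (CycEnvelope aug χ) = (proj aug χ).ker ↔
      ∀ U : Subgroup P, IsOpen (U : Set P) → ∀ z : P, (∀ u ∈ U, z * u = u * z) → z = 1 :=
  ⟨fun h => slim_of_centralizerUnion_le aug χ h.le,
    fun hslim => centralizerUnion_cycEnvelope_eq aug χ hslim hχ⟩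

end CycEnvelope

namespace ThetaEnvData

variable {N : ℕ+} (T : ThetaEnvData.{u} N)

/-- The kernel of `χ ∘ aug` restricted to `Π^tp_Y` is open (continuity of the cyclotomic character).
[cite: MochizukiEtTh2009, Def 2.13 p.47] -/
theorem isOpen_ker_chi_augY : IsOpen (((T.chi.comp T.augY).ker : Subgroup T.PiY) : Set T.PiY) := by
  have h : (((T.chi.comp T.augY).ker : Subgroup T.PiY) : Set T.PiY) =
      Subtype.val ⁻¹' (((T.chi.comp T.aug).ker : Subgroup T.PiX) : Set T.PiX) := by
    ext g; simp [MonoidHom.mem_ker]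
  rw [h]
  exact T.chi_ker_open.preimage continuous_subtype_val

/-- **For EVERY `ThetaEnvData`**: the cyclotome `μ_N = Ker(Π^tp_Y[μ_N] ↠ Π^tp_Y)` lies in the union
of the centralisers of the open subgroups of `Π^tp_Y[μ_N]` — the unconditional half of the named
fact `Cor218_iii_quotient`. [cite: MochizukiEtTh2009, Cor 2.18(iii) p.61] -/
theorem ker_proj_le_centralizerUnion :
    (CycEnvelope.proj T.augY T.chi).ker ≤ centralizerUnion T.env :=
  CycEnvelope.ker_proj_le_centralizerUnion T.augY T.chi T.isOpen_ker_chi_augY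

/-- **Cor 2.18 (iii), quotient clause, CHARACTERISED for every `ThetaEnvData`**: "`Ker(Π• ↠ Π•_Y)`
is the union of the centralisers of the open subgroups of `Π•`" holds for the model environment
`Π^tp_Y[μ_N]` IF AND ONLY IF `Π^tp_Y` is temp-slim. [cite: MochizukiEtTh2009, Cor 2.18(iii) p.61] -/
theorem centralizerUnion_env_eq_ker_iff_slim :
    centralizerUnion T.env = (CycEnvelope.proj T.augY T.chi).ker ↔
      ∀ U : Subgroup T.PiY, IsOpen (U : Set T.PiY) →
        ∀ z : T.PiY, (∀ u ∈ U, z * u = u * z) → z = 1 :=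
  CycEnvelope.centralizerUnion_eq_ker_iff_slim T.augY T.chi T.isOpen_ker_chi_augY

end ThetaEnvData

namespace RigidData

variable {N : ℕ+} {l : ℕ} (R : RigidData.{u} N l)

/-- The named fact `Cor218_iii_quotient` FORCES temp-slimness of `Π^tp_Y`.
[cite: MochizukiEtTh2009, Cor 2.18(iii) p.61] -/
theorem slim_of_cor218_iii_quotient (h : R.Cor218_iii_quotient) :
    ∀ U : Subgroup R.PiY, IsOpen (U : Set R.PiY) →
      ∀ z : R.PiY, (∀ u ∈ U, z * u = u * z) → z = 1 :=
  CycEnvelope.slim_of_centralizerUnion_le R.augY R.chi h.le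

/-- **F-0623 `RigidData.Cor218_iii_quotient` CHARACTERISED, for every `R : RigidData N l`**: the named
fact [EtTh] Cor 2.18 (iii) (quotient clause: `Ker(Π• ↠ Π•_Y)` = the union of the centralisers of the
open subgroups, Prop 2.11 (ii)) holds IF AND ONLY IF `Π^tp_Y` is temp-slim ("every element of
`Π^tp_Y` centralising an open subgroup of `Π^tp_Y` is trivial", [SemiAnbd] Ex. 3.10). The row is
therefore consumable exactly where temp-slimness of `Π^tp_Y` is available, and asserts nothing else.
[cite: MochizukiEtTh2009, Cor 2.18(iii) p.61] -/
theorem cor218_iii_quotient_iff_slim :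
    R.Cor218_iii_quotient ↔
      ∀ U : Subgroup R.PiY, IsOpen (U : Set R.PiY) →
        ∀ z : R.PiY, (∀ u ∈ U, z * u = u * z) → z = 1 :=
  ⟨R.slim_of_cor218_iii_quotient, R.cor218_iii_quotient_of_slim⟩

/-! ## §2. Cor 2.18 (iv), fibres: F-0624 ⟺ identity-inducing automorphisms fix `μ_N` pointwise -/

/-- **The named fact `Cor218_iv_fibre` forces cyclotomic triviality of identity-lifts**: if every
automorphism of the model `M(η)` over the identity of `Π^tp_Y` is a `μ_N`-conjugate of a twist by
`φ ∈ Hom(Π^tp_Y/Π^tp_Ÿ, μ_N)`, then every such automorphism fixes `μ_N = Ker(Π^tp_Y[μ_N] ↠ Π^tp_Y)`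
pointwise (a twist is the identity on `μ_N`, and `μ_N` is commutative).
[cite: MochizukiEtTh2009, Cor 2.18(iv) p.63] -/
theorem inMu_fixed_of_cor218_iv_fibre (h : R.Cor218_iv_fibre) {η : R.PiYdd → R.mu}
    (hη : η ∈ R.thetaCocycles) (α : (R.modelMono hη).Iso (R.modelMono hη))
    (hα : ∀ x, CycEnvelope.proj R.augY R.chi (α.e x) = CycEnvelope.proj R.augY R.chi x) (a : R.mu) :
    α.e (CycEnvelope.inMu R.augY R.chi a) = CycEnvelope.inMu R.augY R.chi a := by
  obtain ⟨φ, -, c, hφ⟩ := (h η hη).1 α hα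
  have hproj : CycEnvelope.proj R.augY R.chi (CycEnvelope.inMu R.augY R.chi a) = 1 :=
    SemidirectProduct.rightHom_inl a
  rw [hφ, hproj, map_one, map_one, one_mul, MulAut.conj_apply, ← map_inv, ← map_mul, ← map_mul,
    mul_inv_cancel_comm]

/-- **Cor 2.18 (iv), fibres, DISCHARGED modulo cyclotomic triviality of identity-lifts** (for every
`R : RigidData N l`): if every automorphism of `M(η)` inducing the identity on `Π^tp_Y` fixes `μ_N`
pointwise, then such automorphisms are, up to `μ_N`-conjugacy, exactly the twists by
`Hom(Π^tp_Y/Π^tp_Ÿ, μ_N)` — seat abc-iut-L2-t10's argument of `cor218_iv_fibre_of_prop214_i` (steps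
(2), (4): the theta section moves within its `μ_N`-conjugacy class by a constant `c`; `conj(c)⁻¹ ∘ α`
fixes `μ_N` and `Im(s^Θ)`, so it is the twist by a cocycle vanishing on `Π^tp_Ÿ`, which by
`augYdd_surjective` and the normality of `Π^tp_Ÿ` is a `χ`-invariant homomorphism), with its step (3)
(Prop 2.14 (i) ⇒ `μ_N` fixed) replaced by the hypothesis. The converse clause (twists are
automorphisms) is `ThetaEnvData.exists_iso_eq_twist`. [cite: MochizukiEtTh2009, Cor 2.18(iv) p.61] -/
theorem cor218_iv_fibre_of_inMu_fixed
    (hfixed : ∀ (η : R.PiYdd → R.mu) (hη : η ∈ R.thetaCocycles)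
      (α : (R.modelMono hη).Iso (R.modelMono hη)),
      (∀ x, CycEnvelope.proj R.augY R.chi (α.e x) = CycEnvelope.proj R.augY R.chi x) →
        ∀ a : R.mu, α.e (CycEnvelope.inMu R.augY R.chi a) = CycEnvelope.inMu R.augY R.chi a) :
    R.Cor218_iv_fibre := by
  have hYdd : ∀ h : R.PiY, ∃ d : R.PiYdd, R.augY (R.inclYdd d) = R.augY h := fun h => by
    obtain ⟨d, hd⟩ := R.augYdd_surjective (R.augY h)
    exact ⟨d, hd⟩
  intro η hη
  refine ⟨fun α hα => ?_, fun φ hφ => R.toThetaEnvData.exists_iso_eq_twist hη φ hφ⟩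
  let A : MulAut R.env := α.e.toMulEquiv
  have hAe : ∀ x, α.e x = A x := fun x => rfl
  have hAright : ∀ x, (A x).right = x.right := hα
  obtain ⟨c, hAs'⟩ := R.exists_conj_sTheta_of_over_id hη α hα
  have hAs : ∀ g, A (R.toThetaEnvData.sTheta hη g) =
      MulAut.conj (CycEnvelope.inMu R.augY R.chi c) (R.toThetaEnvData.sTheta hη g) := hAs'
  have hfix : ∀ a : R.mu, A (CycEnvelope.inMu R.augY R.chi a) = CycEnvelope.inMu R.augY R.chi a :=
    hfixed η hη α hα
  -- normalise: `A' := conj(c⁻¹) ∘ A` fixes `μ_N` and `Im(s^Θ)` pointwise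
  let A' : MulAut R.env := MulAut.conj (CycEnvelope.inMu R.augY R.chi c⁻¹) * A
  have hAA' : ∀ x, A x = MulAut.conj (CycEnvelope.inMu R.augY R.chi c) (A' x) := by
    intro x
    change A x = (MulAut.conj (CycEnvelope.inMu R.augY R.chi c) *
      (MulAut.conj (CycEnvelope.inMu R.augY R.chi c⁻¹) * A)) x
    rw [← mul_assoc, ← map_mul, ← map_mul, mul_inv_cancel, map_one, map_one, one_mul]
  have hA'right : ∀ x, (A' x).right = x.right := by
    intro x
    change (MulAut.conj (CycEnvelope.inMu R.augY R.chi c⁻¹) (A x)).right = x.right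
    rw [MulAut.conj_apply]
    simp [hAright]
  have hA'μ : ∀ a, A' (CycEnvelope.inMu R.augY R.chi a) = CycEnvelope.inMu R.augY R.chi a := by
    intro a
    change MulAut.conj (CycEnvelope.inMu R.augY R.chi c⁻¹) (A (CycEnvelope.inMu R.augY R.chi a)) = _
    rw [hfix]
    exact R.conj_inMu_apply_of_augY_eq_one c⁻¹ _ (by simp)
  have hA's : ∀ g, A' (R.toThetaEnvData.sTheta hη g) = R.toThetaEnvData.sTheta hη g := by
    intro g
    change MulAut.conj (CycEnvelope.inMu R.augY R.chi c⁻¹) (A (R.toThetaEnvData.sTheta hη g)) = _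
    rw [hAs, ← MulAut.mul_apply, ← map_mul, ← map_mul, inv_mul_cancel, map_one, map_one,
      MulAut.one_apply]
  -- the function `φ : Π_Y → μ_N`, `A'(s^alg(g)) = (φ g, g)`
  let sY : R.PiY →* R.env := CycEnvelope.algSection R.augY R.chi
  have hsYdd : ∀ d : R.PiYdd, sY (R.inclYdd d) = R.toThetaEnvData.sAlg d := fun d => rfl
  let φf : R.PiY → R.mu := fun g => (A' (sY g)).left
  have hA'sY : ∀ g, A' (sY g) = ⟨φf g, g⟩ := by
    intro g
    ext
    · rfl
    · rw [hA'right]; rfl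
  have hcoc : ∀ g h, φf (g * h) = φf g * R.chi (R.augY g) (φf h) := by
    intro g h
    have h1 := congrArg SemidirectProduct.left
      (show A' (sY (g * h)) = A' (sY g) * A' (sY h) by rw [map_mul, map_mul])
    rw [hA'sY, hA'sY, hA'sY, SemidirectProduct.mul_left] at h1
    simpa only [MonoidHom.coe_comp, Function.comp_apply] using h1
  have hφdd : ∀ d : R.PiYdd, φf (R.inclYdd d) = 1 := by
    intro d
    have h1 : A' (sY (R.inclYdd d)) = sY (R.inclYdd d) := by
      rw [hsYdd, R.sAlg_eq_inMu_mul_sTheta hη, map_mul, hA'μ, hA's]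
    have h2 := congrArg SemidirectProduct.left h1
    rw [hA'sY] at h2
    simpa [sY] using h2
  -- `χ`-invariance of the values of `φ` (uses the normality of `Π^tp_Ÿ` and `hYdd`)
  have hinv_dd : ∀ (d : R.PiYdd) (h : R.PiY), R.chi (R.augY (R.inclYdd d)) (φf h) = φf h := by
    intro d h
    have h1 : φf (R.inclYdd d * h) = R.chi (R.augY (R.inclYdd d)) (φf h) := by
      rw [hcoc, hφdd, one_mul]
    have hmem : ((h : R.PiX)⁻¹ * (d : R.PiX) * h) ∈ R.PiYdd := by
      have := R.PiYdd_normal.conj_mem _ d.2 (h : R.PiX)⁻¹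
      simpa using this
    have h2 : R.inclYdd d * h = h * R.inclYdd ⟨_, hmem⟩ := by
      apply Subtype.ext
      change (d : R.PiX) * h = h * ((h : R.PiX)⁻¹ * d * h)
      group
    have h3 : φf (h * R.inclYdd ⟨_, hmem⟩) = φf h := by
      rw [hcoc, hφdd, map_one, mul_one]
    rw [← h1, h2, h3]
  have hinv : ∀ g h : R.PiY, R.chi (R.augY g) (φf h) = φf h := by
    intro g h
    obtain ⟨d, hd⟩ := hYdd g
    rw [← hd]
    exact hinv_dd d h
  let φ : R.PiY →* R.mu := MonoidHom.mk' φf (fun g h => by rw [hcoc, hinv])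
  refine ⟨φ, hφdd, c, fun x => ?_⟩
  rw [hAe, hAA']
  congr 1
  calc A' x = A' (CycEnvelope.inMu R.augY R.chi x.left * sY x.right) := by
        rw [CycEnvelope.inMu_mul_algSection]
    _ = CycEnvelope.inMu R.augY R.chi x.left * ⟨φf x.right, x.right⟩ := by
        rw [map_mul, hA'μ, hA'sY]
    _ = CycEnvelope.inMu R.augY R.chi (φ (CycEnvelope.proj R.augY R.chi x)) * x := by
        ext
        · simp only [SemidirectProduct.mul_left, SemidirectProduct.left_inl,
            SemidirectProduct.right_inl, map_one, MulAut.one_apply, φ, MonoidHom.mk'_apply]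
          rw [mul_comm]
          rfl
        · simp

/-- **F-0624 `RigidData.Cor218_iv_fibre` CHARACTERISED, for every `R : RigidData N l`**: the named
fact [EtTh] Cor 2.18 (iv) (fibre clause: the automorphisms of the model mono-theta environment over
the identity of `Π^tp_Y` are, up to `μ_N`-conjugacy, exactly the twists by `Hom(Π^tp_Y/Π^tp_Ÿ, μ_N)`,
and every such twist is an automorphism) holds IF AND ONLY IF every automorphism of `M(η)` inducing
the identity on `Π^tp_Y` fixes the cyclotome `μ_N` pointwise. (Prop 2.14 (i) implies the latter,
`inMu_fixed_of_prop214_i`; at abc-iut-w5-d175's level-`3` toy it fails: the flip inverts `μ_3`.)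
[cite: MochizukiEtTh2009, Cor 2.18(iv) p.61] -/
theorem cor218_iv_fibre_iff_inMu_fixed :
    R.Cor218_iv_fibre ↔
      ∀ (η : R.PiYdd → R.mu) (hη : η ∈ R.thetaCocycles)
        (α : (R.modelMono hη).Iso (R.modelMono hη)),
        (∀ x, CycEnvelope.proj R.augY R.chi (α.e x) = CycEnvelope.proj R.augY R.chi x) →
          ∀ a : R.mu, α.e (CycEnvelope.inMu R.augY R.chi a) = CycEnvelope.inMu R.augY R.chi a :=
  ⟨fun h _ hη α hα => R.inMu_fixed_of_cor218_iv_fibre h hη α hα, R.cor218_iv_fibre_of_inMu_fixed⟩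

end RigidData

/-! ## §3. Cor 2.18 (iii), quotient clause, for the §1 MODEL of `X̲̲` by name -/

namespace ThetaSetting.EtaleThetaData.DoubleUnderline

variable {p : ℕ} [Fact p.Prime] {D : ThetaSetting p} {E : D.EtaleThetaData} {l : ℕ}
  (C : E.DoubleUnderline l) {N : ℕ+} (μ : D.CyclotomeMod l N)

/-- **F-0623 AT THE §1 MODEL, characterised**: for seat abc-iut-L2-t8's rigidity data
`C.rigidData μ hC hS h15 L` of `X̲̲` at level `N`, the named fact Cor 2.18 (iii) (quotient clause)
holds IF AND ONLY IF `Π^tp_Y̲̲` (the model's `Π^tp_Y`, an open subgroup of `Π^tp_X̲̲ ⊆ Π^tp_X`) is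
temp-slim. [cite: MochizukiEtTh2009, Cor 2.18(iii) p.61] -/
theorem rigidData_cor218_iii_quotient_iff (hC : D.Compat) (hS : D.Sec2Hyps) (h15 : Prop15iii E hC)
    (L : C.CuspLabels) :
    (C.rigidData μ hC hS h15 L).Cor218_iii_quotient ↔
      ∀ U : Subgroup (C.rigidData μ hC hS h15 L).PiY,
        IsOpen (U : Set (C.rigidData μ hC hS h15 L).PiY) →
          ∀ z : (C.rigidData μ hC hS h15 L).PiY, (∀ u ∈ U, z * u = u * z) → z = 1 :=
  (C.rigidData μ hC hS h15 L).cor218_iii_quotient_iff_slim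

/-- **F-0623 AT THE §1 MODEL, DISCHARGED modulo temp-slimness of `Π^tp_X`** (the tree's `IsSlimGroup`,
"[SemiAnbd] Ex. 3.10"; interface input of record, GAP-LEDGER family G-w4d021-3): Cor 2.18 (iii),
quotient clause, HOLDS for `C.rigidData μ hC hS h15 L` — abc-iut-L2-d1's `cor218_iii_of_tempSlim`
over `tempSlim_Huu`. [cite: MochizukiEtTh2009, Cor 2.18(iii) p.61] -/
theorem rigidData_cor218_iii_quotient_of_isSlimGroup (hC : D.Compat) (hS : D.Sec2Hyps)
    (h15 : Prop15iii E hC) (L : C.CuspLabels) (hslimX : IsSlimGroup D.PiTemp) :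
    (C.rigidData μ hC hS h15 L).Cor218_iii_quotient :=
  ((C.rigidData μ hC hS h15 L).cor218_iii_of_tempSlim (C.tempSlim_Huu hslimX)).2

/-- **F-0623 AT THE §1 MODEL with `Π^tp_X` temp-slim supplied by the §6 parameter bundle** `d`
(`TemperedCurve.GroupLevelData.isSlimGroup`; ruling η′: a parameter, not a fact).
[cite: MochizukiEtTh2009, Cor 2.18(iii) p.61] -/
theorem rigidData_cor218_iii_quotient_of_groupLevelData (d : D.toTemperedCurve.GroupLevelData)
    (hC : D.Compat) (hS : D.Sec2Hyps) (h15 : Prop15iii E hC) (L : C.CuspLabels) :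
    (C.rigidData μ hC hS h15 L).Cor218_iii_quotient :=
  C.rigidData_cor218_iii_quotient_of_isSlimGroup μ hC hS h15 L d.isSlimGroup

/-- **Both Cor 2.18 (iii) named facts AT THE §1 MODEL** (`Cor218_iii_PiX`: conjugation
`Π^tp_X̲̲ → Aut(Π^tp_Y̲̲)` injective; `Cor218_iii_quotient`), modulo temp-slimness of `Π^tp_X` only.
[cite: MochizukiEtTh2009, Cor 2.18(iii) p.61] -/
theorem rigidData_cor218_iii_of_isSlimGroup (hC : D.Compat) (hS : D.Sec2Hyps)
    (h15 : Prop15iii E hC) (L : C.CuspLabels) (hslimX : IsSlimGroup D.PiTemp) :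
    (C.rigidData μ hC hS h15 L).Cor218_iii_PiX ∧ (C.rigidData μ hC hS h15 L).Cor218_iii_quotient :=
  (C.rigidData μ hC hS h15 L).cor218_iii_of_tempSlim (C.tempSlim_Huu hslimX)

end ThetaSetting.EtaleThetaData.DoubleUnderline

end Literature.AnabelianGeometry.EtaleTheta

end
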